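import Mathlib

/-!
# Gap products of a FULLY OCCUPIED face span (arithmetic core of the FULL-OCCUPANCY FACE LAW of the α register)

This lineage's ENS / face-rule lane on the static symmetric tridiagonal register of `WeakLifting` (stmt-ValiantsHypothesis-19561); sequel of
`…TridiagonalRealStaticGapProductFour.lean` / `…GapProductOneThree.lean`, which are the cases `(a,b) = (1,2)` and `(1,3)` of the present file.

For a finite set `S` of integers containing the WHOLE lattice interval `{0, 1, …, a+b}` (`1 ≤ a < b`) — a face with extreme values `0`, `a+b`,
middle values `a`, `b`, and every other lattice point of its span occupied — the gap products `W(v) = ∏_{w ∈ S, w ≠ v} |v − w|` satisfy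
`W(a) · W(b) < W(0) · W(a+b)` (`gapProduct_fullSpan_int`), i.e. the ENS face inequality «middles dominate» FAILS.  Mechanism: the interval
contributes `v!·(a+b−v)!` to `W(v)` (`prod_abs_sub_range_erase`), i.e. `((a+b)!)²` to the extremes against `(a! b!)²` to the middles — a factor
`C(a+b, a)²`; a point of `S` at offset `j ≥ 1` beyond an extreme contributes `(j+a)(j+b)` to the middles against `j(j+a+b)` to the extremes, and on
each side these ratios telescope: `∏_{j ≤ N} (j+a)(j+b)/(j(j+a+b)) = C(a+b,a) · ∏_{i ≤ a} (N+i)/(N+b+i) < C(a+b, a)` (`prod_ratio_Icc_eq`,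
`prod_shift_lt_choose_mul`).  `gapProduct_fullSpan` is the same for an injective integer labelling of a finite index set on a lattice `c + gℤ`.

HONEST FRAMING: elementary arithmetic; nothing here is about pencils, `WeakLifting`, Conjecture B, `MatrixDescartes` (18050) or `VP ≠ VNP`.
Seat: prover val-sym-lift-p2 g18, `--supports stmt-ValiantsHypothesis-19561`.
-/

set_option linter.dupNamespace false
set_option autoImplicit false

namespace Summit.ValiantsHypothesis.ValiantsHypothesis.Theorems.KPlusLogSqLaw

namespace EdgeNormalForm

open Finset

/-! ## 1. Factorial products over a lattice interval -/

/-- `∏_{w < v} (v − w) = v!`. [folklore] -/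
theorem prod_range_sub_eq_factorial (v : ℕ) : ∏ w ∈ range v, ((v : ℝ) - w) = (v.factorial : ℝ) := by
  induction v with
  | zero => simp
  | succ v ih =>
    rw [Finset.prod_range_succ', Nat.factorial_succ]
    push_cast
    have : ∏ k ∈ range v, ((v : ℝ) + 1 - ((k : ℝ) + 1)) = ∏ w ∈ range v, ((v : ℝ) - w) :=
      Finset.prod_congr rfl fun k _ => by ring
    rw [this, ih]
    ring

/-- **the interval contribution**: `∏_{w ∈ {0..v+e} ∖ {v}} |v − w| = v! · e!`. [folklore] -/
theorem prod_abs_sub_range_erase (v e : ℕ) :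
    ∏ w ∈ (range (v + e + 1)).erase v, |(v : ℝ) - w| = (v.factorial : ℝ) * e.factorial := by
  induction e with
  | zero =>
    rw [add_zero, Finset.range_add_one, Finset.erase_insert (by simp), Nat.factorial_zero, Nat.cast_one, mul_one,
      ← prod_range_sub_eq_factorial]
    exact Finset.prod_congr rfl fun w hw => abs_of_nonneg (by
      have := Finset.mem_range.mp hw; exact sub_nonneg.mpr (by exact_mod_cast this.le))
  | succ e ih =>
    rw [show v + (e + 1) + 1 = (v + e + 1) + 1 by ring, Finset.range_add_one,
      Finset.erase_insert_of_ne (by omega), Finset.prod_insert (by simp), ih, Nat.factorial_succ]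
    push_cast
    rw [show ((v : ℝ) - ((v : ℝ) + e + 1)) = -((e : ℝ) + 1) by ring, abs_neg, abs_of_pos (by positivity)]
    ring

/-! ## 2. The external offsets telescope (general `a`, `b`) -/

/-- closed form of the telescoping product. [folklore] -/
theorem prod_ratio_Icc_eq (a b N : ℕ) :
    (∏ j ∈ Icc 1 N, ((((j : ℝ) + a) * ((j : ℝ) + b)) / ((j : ℝ) * ((j : ℝ) + a + b)))) *
        ((N.factorial : ℝ) * (N + a + b).factorial * a.factorial * b.factorial) =
      ((N + a).factorial : ℝ) * (N + b).factorial * (a + b).factorial := by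
  induction N with
  | zero => simp; ring
  | succ N ih =>
    rw [Finset.prod_Icc_succ_top (by omega)]
    have hfac : ∀ n : ℕ, ((n + 1).factorial : ℝ) = (n + 1) * n.factorial := fun n => by
      rw [Nat.factorial_succ]; push_cast; ring
    rw [show N + 1 + a + b = (N + a + b) + 1 by ring, show N + 1 + a = (N + a) + 1 by ring, show N + 1 + b = (N + b) + 1 by ring,
      hfac, hfac, hfac, hfac]
    set P := ∏ j ∈ Icc 1 N, ((((j : ℝ) + a) * ((j : ℝ) + b)) / ((j : ℝ) * ((j : ℝ) + a + b))) with hP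
    have hne : ((N : ℝ) + 1) * (((N : ℝ) + 1) + a + b) ≠ 0 := by positivity
    have hR' : ((((N + 1 : ℕ) : ℝ) + a) * (((N + 1 : ℕ) : ℝ) + b)) / ((((N + 1 : ℕ) : ℝ)) * ((((N + 1 : ℕ) : ℝ)) + a + b)) *
        (((N : ℝ) + 1) * (((N : ℝ) + 1) + a + b)) = ((N : ℝ) + 1 + a) * ((N : ℝ) + 1 + b) := by
      push_cast
      rw [div_mul_cancel₀ _ hne]
    calc P * (((((N + 1 : ℕ) : ℝ) + a) * (((N + 1 : ℕ) : ℝ) + b)) / ((((N + 1 : ℕ) : ℝ)) * ((((N + 1 : ℕ) : ℝ)) + a + b))) *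
          (((N : ℝ) + 1) * (N.factorial : ℝ) * ((((N + a + b : ℕ) : ℝ) + 1) * ((N + a + b).factorial : ℝ)) * a.factorial * b.factorial)
        = (P * ((N.factorial : ℝ) * (N + a + b).factorial * a.factorial * b.factorial)) *
          (((((N + 1 : ℕ) : ℝ) + a) * (((N + 1 : ℕ) : ℝ) + b)) / ((((N + 1 : ℕ) : ℝ)) * ((((N + 1 : ℕ) : ℝ)) + a + b)) *
            (((N : ℝ) + 1) * (((N : ℝ) + 1) + a + b))) := by push_cast; ring
      _ = ((N + a).factorial : ℝ) * (N + b).factorial * (a + b).factorial * (((N : ℝ) + 1 + a) * ((N : ℝ) + 1 + b)) := by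
          rw [ih, hR']
      _ = (((N + a : ℕ) : ℝ) + 1) * ((N + a).factorial : ℝ) * ((((N + b : ℕ) : ℝ) + 1) * ((N + b).factorial : ℝ)) *
          ((a + b).factorial : ℝ) := by push_cast; ring

/-- the factorial inequality behind `C(a+b,a) > ∏ (j+a)(j+b)/(j(j+a+b))`: `(N+a)! (N+b)! < N! (N+a+b)!` for `a, b ≥ 1`. [folklore] -/
theorem factorial_mul_factorial_lt (N : ℕ) : ∀ (a b : ℕ), 1 ≤ a → 1 ≤ b →
    (N + a).factorial * (N + b).factorial < N.factorial * (N + a + b).factorial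
  | 0, _, ha, _ => absurd ha (by omega)
  | 1, b, _, hb => by
    rw [show N + 1 + b = (N + b) + 1 by ring, Nat.factorial_succ, Nat.factorial_succ (N + b)]
    have hP : 0 < N.factorial * (N + b).factorial := Nat.mul_pos (Nat.factorial_pos N) (Nat.factorial_pos _)
    calc (N + 1) * N.factorial * (N + b).factorial = (N + 1) * (N.factorial * (N + b).factorial) := by ring
      _ < (N + b + 1) * (N.factorial * (N + b).factorial) := (Nat.mul_lt_mul_right hP).mpr (by omega)
      _ = N.factorial * ((N + b + 1) * (N + b).factorial) := by ring
  | (a + 2), b, _, hb => by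
    have ih := factorial_mul_factorial_lt N (a + 1) b (by omega) hb
    rw [show N + (a + 2) = (N + (a + 1)) + 1 by ring, Nat.factorial_succ,
      show N + (a + 1) + 1 + b = (N + (a + 1) + b) + 1 by ring, Nat.factorial_succ (N + (a + 1) + b)]
    have h3 : N + (a + 1) + 1 ≤ N + (a + 1) + b + 1 := by omega
    calc (N + (a + 1) + 1) * (N + (a + 1)).factorial * (N + b).factorial
        = (N + (a + 1) + 1) * ((N + (a + 1)).factorial * (N + b).factorial) := by ring
      _ < (N + (a + 1) + 1) * (N.factorial * (N + (a + 1) + b).factorial) := (Nat.mul_lt_mul_left (by omega)).mpr ih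
      _ ≤ (N + (a + 1) + b + 1) * (N.factorial * (N + (a + 1) + b).factorial) := Nat.mul_le_mul_right _ h3
      _ = N.factorial * ((N + (a + 1) + b + 1) * (N + (a + 1) + b).factorial) := by ring

/-- **per-side bound**: for a finite set `S` of POSITIVE integers, `∏_{j∈S} (j+a)(j+b) < C(a+b, a) · ∏_{j∈S} j(j+a+b)` (`a, b ≥ 1`). [folklore] -/
theorem prod_shift_lt_choose_mul (a b : ℕ) (ha : 1 ≤ a) (hb : 1 ≤ b) (S : Finset ℕ) (hS : ∀ j ∈ S, 1 ≤ j) :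
    ∏ j ∈ S, (((j : ℝ) + a) * ((j : ℝ) + b)) < ((a + b).choose a : ℝ) * ∏ j ∈ S, ((j : ℝ) * ((j : ℝ) + a + b)) := by
  have hpos : 0 < ∏ j ∈ S, ((j : ℝ) * ((j : ℝ) + a + b)) :=
    Finset.prod_pos fun j hj => mul_pos (by exact_mod_cast hS j hj) (by positivity)
  have hchoose : ((a + b).choose a : ℝ) * (a.factorial * b.factorial) = (a + b).factorial := by
    have h := Nat.choose_mul_factorial_mul_factorial (Nat.le_add_right a b)
    rw [Nat.add_sub_cancel_left] at h
    exact_mod_cast (by rw [← mul_assoc]; exact h)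
  -- `N` = a bound for `S`
  set N := S.sup id with hN
  have hsub : S ⊆ Icc 1 N := fun j hj => Finset.mem_Icc.mpr ⟨hS j hj, Finset.le_sup (f := id) hj⟩
  -- ratio over `S` ≤ ratio over `Icc 1 N`
  set R : ℕ → ℝ := fun j => (((j : ℝ) + a) * ((j : ℝ) + b)) / ((j : ℝ) * ((j : ℝ) + a + b)) with hR
  have hR1 : ∀ j, 1 ≤ j → 1 ≤ R j := fun j hj => by
    have hj' : (1 : ℝ) ≤ j := by exact_mod_cast hj
    rw [hR, le_div_iff₀ (by positivity)]
    have : (0 : ℝ) ≤ (a : ℝ) * b := by positivity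
    nlinarith
  have hle : ∏ j ∈ S, R j ≤ ∏ j ∈ Icc 1 N, R j := by
    have hext : ∏ j ∈ S, R j = ∏ j ∈ Icc 1 N, (if j ∈ S then R j else 1) := by
      rw [Finset.prod_ite_mem, Finset.inter_eq_right.mpr hsub]
    rw [hext]
    refine Finset.prod_le_prod (fun j hj => ?_) (fun j hj => ?_)
    · split_ifs
      · exact (zero_le_one.trans (hR1 j (Finset.mem_Icc.mp hj).1))
      · exact zero_le_one
    · split_ifs
      · exact le_rfl
      · exact hR1 j (Finset.mem_Icc.mp hj).1
  -- the `Icc` product is `< C(a+b,a)` by the closed form and the factorial inequality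
  have hT : (∏ j ∈ Icc 1 N, R j) < ((a + b).choose a : ℝ) := by
    have hid := prod_ratio_Icc_eq a b N
    have hfl := factorial_mul_factorial_lt N a b ha hb
    have hD : (0 : ℝ) < (N.factorial : ℝ) * (N + a + b).factorial * a.factorial * b.factorial := by positivity
    refine lt_of_mul_lt_mul_right ?_ hD.le
    simp only [hR] at hid ⊢
    rw [hid]
    have hfl' : ((N + a).factorial : ℝ) * (N + b).factorial < (N.factorial : ℝ) * (N + a + b).factorial := by exact_mod_cast hfl
    have hchoose' : ((a + b).choose a : ℝ) * ((N.factorial : ℝ) * (N + a + b).factorial * a.factorial * b.factorial) =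
        (N.factorial : ℝ) * (N + a + b).factorial * (a + b).factorial := by
      rw [← hchoose]; ring
    rw [hchoose']
    have hab : (0 : ℝ) < (a + b).factorial := by positivity
    nlinarith
  -- assemble
  have hsplit : ∏ j ∈ S, (((j : ℝ) + a) * ((j : ℝ) + b)) = (∏ j ∈ S, R j) * ∏ j ∈ S, ((j : ℝ) * ((j : ℝ) + a + b)) := by
    rw [← Finset.prod_mul_distrib]
    refine Finset.prod_congr rfl fun j hj => ?_
    have : (j : ℝ) * ((j : ℝ) + a + b) ≠ 0 := ne_of_gt (mul_pos (by exact_mod_cast hS j hj) (by positivity))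
    rw [hR, div_mul_cancel₀ _ this]
  rw [hsplit]
  exact (mul_le_mul_of_nonneg_right hle hpos.le).trans_lt (mul_lt_mul_of_pos_right hT hpos)

/-! ## 3. The gap products of a fully occupied span -/

/-- **FULL SPAN BEATS THE FACE RULE (integer sets).**  If a finite set `S ⊆ ℤ` contains every integer of `[0, a+b]` (`1 ≤ a < b`), then with
`W(v) = ∏_{w ∈ S ∖ {v}} |v − w|`: `W(a) · W(b) < W(0) · W(a+b)`. [this work] -/
theorem gapProduct_fullSpan_int (a b : ℕ) (ha : 1 ≤ a) (hab : a < b) (S : Finset ℤ) (hJ : ∀ i : ℕ, i ≤ a + b → (i : ℤ) ∈ S) :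
    (∏ w ∈ S.erase (a : ℤ), |((a : ℤ) : ℝ) - w|) * (∏ w ∈ S.erase (b : ℤ), |((b : ℤ) : ℝ) - w|) <
      (∏ w ∈ S.erase (0 : ℤ), |((0 : ℤ) : ℝ) - w|) * (∏ w ∈ S.erase ((a + b : ℕ) : ℤ), |(((a + b : ℕ) : ℤ) : ℝ) - w|) := by
  set n := a + b with hn
  set Jz : Finset ℤ := (range (n + 1)).image (fun i : ℕ => (i : ℤ)) with hJz
  have hJzS : Jz ⊆ S := by
    intro w hw
    obtain ⟨i, hi, rfl⟩ := Finset.mem_image.mp hw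
    exact hJ i (by have := Finset.mem_range.mp hi; omega)
  set Ext : Finset ℤ := S \ Jz with hExt
  have hExt_out : ∀ w ∈ Ext, w < 0 ∨ (n : ℤ) < w := by
    intro w hw
    obtain ⟨hwS, hwJ⟩ := Finset.mem_sdiff.mp hw
    by_contra h
    rw [not_or, not_lt, not_lt] at h
    refine hwJ (Finset.mem_image.mpr ⟨w.toNat, Finset.mem_range.mpr ?_, ?_⟩)
    · have := Int.toNat_of_nonneg h.1; omega
    · exact Int.toNat_of_nonneg h.1
  -- decomposition of `W(v)` for `v` in the interval
  have hW : ∀ v : ℕ, v ≤ n → ∏ w ∈ S.erase (v : ℤ), |((v : ℤ) : ℝ) - w| =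
      ((v.factorial : ℝ) * (n - v).factorial) * ∏ w ∈ Ext, |((v : ℤ) : ℝ) - w| := by
    intro v hv
    have hvJ : (v : ℤ) ∈ Jz := Finset.mem_image.mpr ⟨v, Finset.mem_range.mpr (by omega), rfl⟩
    have hdec : S.erase (v : ℤ) = (Jz.erase (v : ℤ)) ∪ Ext := by
      ext w
      simp only [Finset.mem_erase, Finset.mem_union, hExt, Finset.mem_sdiff]
      constructor
      · rintro ⟨hne, hwS⟩
        by_cases hwJ : w ∈ Jz
        · exact Or.inl ⟨hne, hwJ⟩
        · exact Or.inr ⟨hwS, hwJ⟩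
      · rintro (⟨hne, hwJ⟩ | ⟨hwS, hwJ⟩)
        · exact ⟨hne, hJzS hwJ⟩
        · exact ⟨fun h => hwJ (h ▸ hvJ), hwS⟩
    have hdisj : Disjoint (Jz.erase (v : ℤ)) Ext := by
      rw [hExt]; exact Finset.disjoint_of_subset_left (Finset.erase_subset _ _) Finset.disjoint_sdiff
    rw [hdec, Finset.prod_union hdisj]
    congr 1
    -- the interval part
    have himg : Jz.erase (v : ℤ) = ((range (n + 1)).erase v).image (fun i : ℕ => (i : ℤ)) := by
      rw [hJz, Finset.image_erase Nat.cast_injective]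
    rw [himg, Finset.prod_image (fun i _ j _ h => by exact_mod_cast h)]
    obtain ⟨e, he⟩ : ∃ e, n = v + e := ⟨n - v, by omega⟩
    rw [he, show v + e - v = e by omega, ← prod_abs_sub_range_erase v e]
    exact Finset.prod_congr rfl fun i _ => by push_cast; ring_nf
  have hW0 := hW 0 (by omega)
  rw [Nat.cast_zero] at hW0
  rw [hW a (by omega), hW b (by omega), hW0, hW n le_rfl]
  rw [show n - a = b by omega, show n - b = a by omega, Nat.sub_zero, Nat.sub_self, Nat.factorial_zero]
  push_cast
  -- offsets of the externals
  set joff : ℤ → ℕ := fun w => (if w < 0 then -w else w - n).toNat with hjoff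
  have hj : ∀ w ∈ Ext, 1 ≤ joff w ∧ ((w < 0 ∧ (w : ℝ) = -(joff w : ℝ)) ∨ ((n : ℤ) < w ∧ (w : ℝ) = n + joff w)) := by
    intro w hw
    rcases hExt_out w hw with h | h
    · have e : (joff w : ℤ) = -w := by simp only [hjoff, if_pos h]; omega
      refine ⟨by omega, Or.inl ⟨h, ?_⟩⟩
      have e' : ((joff w : ℤ) : ℝ) = -(w : ℝ) := by exact_mod_cast e
      push_cast at e'; linarith
    · have hn' : ¬ w < 0 := by omega
      have e : (joff w : ℤ) = w - n := by simp only [hjoff, if_neg hn']; omega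
      refine ⟨by omega, Or.inr ⟨h, ?_⟩⟩
      have e' : ((joff w : ℤ) : ℝ) = (w : ℝ) - n := by exact_mod_cast e
      push_cast at e'; linarith
  have hnn : (n : ℝ) = a + b := by rw [hn]; push_cast; ring
  have fE : ∀ w ∈ Ext, |(0 : ℝ) - w| * |(n : ℝ) - w| = (joff w : ℝ) * ((joff w : ℝ) + a + b) := by
    intro w hw
    obtain ⟨_, h⟩ := hj w hw
    have hj0 : (0 : ℝ) ≤ joff w := by positivity
    rcases h with ⟨_, e⟩ | ⟨_, e⟩ <;> rw [e]
    · rw [show (0 : ℝ) - -(joff w : ℝ) = joff w by ring, show (n : ℝ) - -(joff w : ℝ) = joff w + a + b by rw [hnn]; ring,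
        abs_of_nonneg hj0, abs_of_nonneg (by positivity)]
    · rw [show (0 : ℝ) - ((n : ℝ) + joff w) = -(joff w + a + b) by rw [hnn]; ring, show (n : ℝ) - ((n : ℝ) + joff w) = -(joff w) by ring,
        abs_neg, abs_neg, abs_of_nonneg hj0, abs_of_nonneg (by positivity), mul_comm]
  have fM : ∀ w ∈ Ext, |(a : ℝ) - w| * |(b : ℝ) - w| = ((joff w : ℝ) + a) * ((joff w : ℝ) + b) := by
    intro w hw
    obtain ⟨_, h⟩ := hj w hw
    have hj0 : (0 : ℝ) ≤ joff w := by positivity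
    rcases h with ⟨_, e⟩ | ⟨_, e⟩ <;> rw [e]
    · rw [show (a : ℝ) - -(joff w : ℝ) = joff w + a by ring, show (b : ℝ) - -(joff w : ℝ) = joff w + b by ring,
        abs_of_nonneg (by positivity), abs_of_nonneg (by positivity)]
    · rw [show (a : ℝ) - ((n : ℝ) + joff w) = -(joff w + b) by rw [hnn]; ring,
        show (b : ℝ) - ((n : ℝ) + joff w) = -(joff w + a) by rw [hnn]; ring,
        abs_neg, abs_neg, abs_of_nonneg (by positivity), abs_of_nonneg (by positivity), mul_comm]
  -- regroup both sides
  have hL : ((a.factorial : ℝ) * b.factorial * ∏ w ∈ Ext, |(a : ℝ) - w|) *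
      ((b.factorial : ℝ) * a.factorial * ∏ w ∈ Ext, |(b : ℝ) - w|) =
      ((a.factorial : ℝ) * b.factorial) ^ 2 * ∏ w ∈ Ext, (((joff w : ℝ) + a) * ((joff w : ℝ) + b)) := by
    rw [← Finset.prod_congr rfl fM, Finset.prod_mul_distrib]; ring
  have hR : ((1 : ℝ) * n.factorial * ∏ w ∈ Ext, |(0 : ℝ) - w|) *
      ((n.factorial : ℝ) * 1 * ∏ w ∈ Ext, |(n : ℝ) - w|) =
      ((n.factorial : ℝ)) ^ 2 * ∏ w ∈ Ext, ((joff w : ℝ) * ((joff w : ℝ) + a + b)) := by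
    rw [← Finset.prod_congr rfl fE, Finset.prod_mul_distrib]; ring
  have hgoal : ((a.factorial : ℝ) * b.factorial) ^ 2 * ∏ w ∈ Ext, (((joff w : ℝ) + a) * ((joff w : ℝ) + b)) <
      ((n.factorial : ℝ)) ^ 2 * ∏ w ∈ Ext, ((joff w : ℝ) * ((joff w : ℝ) + a + b)) := by
    -- split by side; offsets injective on each side
    set ExtL := Ext.filter (fun w => w < 0) with hExtL
    set ExtR := Ext.filter (fun w => ¬ w < 0) with hExtR
    have hsplit : ∀ g : ℤ → ℝ, ∏ w ∈ Ext, g w = (∏ w ∈ ExtL, g w) * ∏ w ∈ ExtR, g w := fun g =>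
      (Finset.prod_filter_mul_prod_filter_not Ext (fun w => w < 0) g).symm
    have hinjL : Set.InjOn joff ExtL := by
      intro w hw w' hw' h
      have hwm := (Finset.mem_filter.mp (Finset.mem_coe.mp hw)).2
      have hw'm := (Finset.mem_filter.mp (Finset.mem_coe.mp hw')).2
      have e1 : (joff w : ℤ) = -w := by simp only [hjoff, if_pos hwm]; omega
      have e2 : (joff w' : ℤ) = -w' := by simp only [hjoff, if_pos hw'm]; omega
      have hz : (joff w : ℤ) = (joff w' : ℤ) := by rw [h]
      omega
    have hinjR : Set.InjOn joff ExtR := by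
      intro w hw w' hw' h
      have hwm := Finset.mem_filter.mp (Finset.mem_coe.mp hw)
      have hw'm := Finset.mem_filter.mp (Finset.mem_coe.mp hw')
      have e1 : (joff w : ℤ) = w - n := by simp only [hjoff, if_neg hwm.2]; have := hExt_out w hwm.1; omega
      have e2 : (joff w' : ℤ) = w' - n := by simp only [hjoff, if_neg hw'm.2]; have := hExt_out w' hw'm.1; omega
      have hz : (joff w : ℤ) = (joff w' : ℤ) := by rw [h]
      omega
    have hposL : ∀ j ∈ ExtL.image joff, 1 ≤ j := by
      intro j hjm; obtain ⟨w, hw, rfl⟩ := Finset.mem_image.mp hjm; exact (hj w (Finset.mem_filter.mp hw).1).1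
    have hposR : ∀ j ∈ ExtR.image joff, 1 ≤ j := by
      intro j hjm; obtain ⟨w, hw, rfl⟩ := Finset.mem_image.mp hjm; exact (hj w (Finset.mem_filter.mp hw).1).1
    have hL' := prod_shift_lt_choose_mul a b ha (by omega) (ExtL.image joff) hposL
    have hR' := prod_shift_lt_choose_mul a b ha (by omega) (ExtR.image joff) hposR
    rw [Finset.prod_image hinjL, Finset.prod_image hinjL] at hL'
    rw [Finset.prod_image hinjR, Finset.prod_image hinjR] at hR'
    rw [hsplit (fun w => ((joff w : ℝ) + a) * ((joff w : ℝ) + b)), hsplit (fun w => (joff w : ℝ) * ((joff w : ℝ) + a + b))]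
    have hpL : 0 < ∏ w ∈ ExtL, ((joff w : ℝ) * ((joff w : ℝ) + a + b)) :=
      Finset.prod_pos fun w hw => mul_pos (by exact_mod_cast (hj w (Finset.mem_filter.mp hw).1).1) (by positivity)
    have hpR : 0 < ∏ w ∈ ExtR, ((joff w : ℝ) * ((joff w : ℝ) + a + b)) :=
      Finset.prod_pos fun w hw => mul_pos (by exact_mod_cast (hj w (Finset.mem_filter.mp hw).1).1) (by positivity)
    have hnL : 0 ≤ ∏ w ∈ ExtL, (((joff w : ℝ) + a) * ((joff w : ℝ) + b)) := Finset.prod_nonneg fun w _ => by positivity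
    have hprod := mul_lt_mul'' hL' hR' hnL (Finset.prod_nonneg fun w _ => by positivity)
    -- `(n!)² = C(n,a)² (a! b!)²`
    have hchoose : ((a + b).choose a : ℝ) * (a.factorial * b.factorial) = (a + b).factorial := by
      have h := Nat.choose_mul_factorial_mul_factorial (Nat.le_add_right a b)
      rw [Nat.add_sub_cancel_left] at h
      exact_mod_cast (by rw [← mul_assoc]; exact h)
    have hnf : (n.factorial : ℝ) = ((a + b).choose a : ℝ) * (a.factorial * b.factorial) := by rw [hchoose]
    rw [hnf]
    have hfpos : (0 : ℝ) < (a.factorial : ℝ) * b.factorial := by positivity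
    nlinarith [hprod, mul_pos hfpos hfpos, mul_pos (mul_pos hfpos hfpos) (mul_pos hpL hpR)]
  rw [hL, hR]
  exact hgoal

/-! ## 4. Lattice / labelling form -/

/-- **FULL SPAN BEATS THE FACE RULE (labelled, lattice form).**  For an injective integer labelling `z` of a finite set `Act` on the lattice
`c + gℤ`, with members of the face values `c`, `c + a g`, `c + b g`, `c + (a+b) g` (`1 ≤ a < b`) and EVERY lattice point `c + i g`,
`0 ≤ i ≤ a + b`, attained on `Act`, the gap products satisfy `W_{c+ag} · W_{c+bg} < W_c · W_{c+(a+b)g}`. [this work] -/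
theorem gapProduct_fullSpan {ι : Type*} [DecidableEq ι] (Act : Finset ι) (z : ι → ℤ)
    (hinj : ∀ P ∈ Act, ∀ Q ∈ Act, z P = z Q → P = Q) (a b : ℕ) (ha : 1 ≤ a) (hab : a < b)
    (c g : ℤ) (hg : 0 < g) (hmod : ∀ Q ∈ Act, g ∣ z Q - c)
    (hocc : ∀ i : ℕ, i ≤ a + b → ∃ Q ∈ Act, z Q = c + i * g)
    {E₁ M₁ M₂ E₂ : ι} (hE₁ : E₁ ∈ Act) (hM₁ : M₁ ∈ Act) (hM₂ : M₂ ∈ Act) (hE₂ : E₂ ∈ Act)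
    (zE₁ : z E₁ = c) (zM₁ : z M₁ = c + a * g) (zM₂ : z M₂ = c + b * g) (zE₂ : z E₂ = c + (a + b : ℕ) * g) :
    (∏ Q ∈ Act.erase M₁, |((z M₁ : ℝ)) - z Q|) * (∏ Q ∈ Act.erase M₂, |((z M₂ : ℝ)) - z Q|) <
      (∏ Q ∈ Act.erase E₁, |((z E₁ : ℝ)) - z Q|) * (∏ Q ∈ Act.erase E₂, |((z E₂ : ℝ)) - z Q|) := by
  -- rescaled labels and their value set
  set z' : ι → ℤ := fun Q => (z Q - c) / g with hz'
  have hzz' : ∀ Q ∈ Act, z Q = c + g * z' Q := fun Q hQ => by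
    have := Int.ediv_mul_cancel (hmod Q hQ); simp only [hz']; linarith [this]
  have hinj' : ∀ P ∈ Act, ∀ Q ∈ Act, z' P = z' Q → P = Q := fun P hP Q hQ h =>
    hinj P hP Q hQ (by rw [hzz' P hP, hzz' Q hQ, h])
  have hg0 : (g : ℤ) ≠ 0 := ne_of_gt hg
  have hval : ∀ Q ∈ Act, ∀ i : ℤ, z Q = c + i * g → z' Q = i := fun Q _ i h => by
    simp only [hz', h, add_sub_cancel_left, Int.mul_ediv_cancel _ hg0]
  set S : Finset ℤ := Act.image z' with hS
  have hJ : ∀ i : ℕ, i ≤ a + b → (i : ℤ) ∈ S := by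
    intro i hi
    obtain ⟨Q, hQ, hzQ⟩ := hocc i hi
    exact Finset.mem_image.mpr ⟨Q, hQ, hval Q hQ i hzQ⟩
  have key := gapProduct_fullSpan_int a b ha hab S hJ
  -- each labelled gap product is `g^(#Act − 1)` times the value-set gap product
  have hresc : ∀ P ∈ Act, ∏ Q ∈ Act.erase P, |((z P : ℝ)) - z Q| =
      (g : ℝ) ^ (Act.erase P).card * ∏ w ∈ S.erase (z' P), |((z' P : ℝ)) - w| := by
    intro P hP
    have himg : S.erase (z' P) = (Act.erase P).image z' := by
      ext w
      simp only [hS, Finset.mem_erase, Finset.mem_image]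
      constructor
      · rintro ⟨hne, Q, hQ, rfl⟩
        exact ⟨Q, ⟨fun h => hne (by rw [h]), hQ⟩, rfl⟩
      · rintro ⟨Q, ⟨hQP, hQ⟩, rfl⟩
        exact ⟨fun h => hQP (hinj' Q hQ P hP h), Q, hQ, rfl⟩
    rw [himg, Finset.prod_image (fun Q hQ Q' hQ' h =>
      hinj' Q (Finset.mem_of_mem_erase hQ) Q' (Finset.mem_of_mem_erase hQ') h), Finset.pow_card_mul_prod]
    refine Finset.prod_congr rfl fun Q hQ => ?_
    rw [hzz' P hP, hzz' Q (Finset.mem_of_mem_erase hQ)]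
    push_cast
    rw [show ((c : ℝ) + g * (z' P) - (c + g * (z' Q))) = g * ((z' P : ℝ) - z' Q) by ring, abs_mul,
      abs_of_pos (by exact_mod_cast hg : (0 : ℝ) < g)]
  have hcardP : ∀ P ∈ Act, (Act.erase P).card = Act.card - 1 := fun P hP => Finset.card_erase_of_mem hP
  have v1 : z' E₁ = 0 := hval E₁ hE₁ 0 (by rw [zE₁]; ring)
  have v2 : z' M₁ = a := hval M₁ hM₁ a zM₁
  have v3 : z' M₂ = b := hval M₂ hM₂ b zM₂
  have v4 : z' E₂ = ((a + b : ℕ) : ℤ) := hval E₂ hE₂ _ zE₂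
  rw [hresc M₁ hM₁, hresc M₂ hM₂, hresc E₁ hE₁, hresc E₂ hE₂, hcardP M₁ hM₁, hcardP M₂ hM₂, hcardP E₁ hE₁, hcardP E₂ hE₂,
    v1, v2, v3, v4]
  have hgpos : (0 : ℝ) < (g : ℝ) ^ (Act.card - 1) := pow_pos (by exact_mod_cast hg) _
  nlinarith [mul_pos hgpos hgpos, key]

end EdgeNormalForm

end Summit.ValiantsHypothesis.ValiantsHypothesis.Theorems.KPlusLogSqLaw
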